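import Mathlib
import HarnessLib
import Summits.NavierStokesRegularity.NavierStokesRegularity.Theorems.PoloidalWindowDoorPoloidalWindowRigidityUntwistedSeparation

/-!
# Route `PoloidalWindowDoor`, crux `PoloidalWindowRigidity` (K2, stmt-NavierStokesRegularity-19708), skeleton `lrc-jet` v5,
# stub `stub_untwisted` — brick F4-tr-c: THE TWO BRANCH WRONSKIANS ARE `w`-DERIVATIVES OF VERTICAL LOGARITHMIC DERIVATIVES
# (`D₁ = Λ² ∂_w η`, `D₃ = N²(Λ − ∂_w ξ + ∂_w η)` with `η = P_w + Λ̇/Λ`, `ξ = P_w − Λ̇/(1−Λ)`, `N = Λ(1−Λ)`)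

Cell ns-regularity-ideate, K2 lead ns-poloidal-K2-p1 (gen 6; `--supports stmt-NavierStokesRegularity-19708`, helper; BRIEF-v5-bricks-v2 (S4); CAS kit j283927
and j284673).  Pure two-variable calculus on the structure functions `P, Λ : ℝ × ℝ → ℝ` of an untwisted poloidal germ (functions of `(w, z)`); no `ℝ³`.

For `p = (w,z)` write `Pw = DP(p)(1,0)`, `Lw = DΛ(p)(1,0)`, `Lz = DΛ(p)(0,1)`, `Pww, Lww, Lwz` for the `w`-derivatives of `Pw, Lw` and the `z`-derivative of `Lw`,
`Ld = DΛ(p)(P(p),1) = P·Lw + Lz` and `Lwd = D(Lw)(p)(P(p),1) = P·Lww + Lwz` (the derivatives ALONG THE VERTICAL LINE used by bricks F3a/F3b).  The two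
quantities whose vanishing defines Branch 2b,
  `D₁ = Λ(ΛPww + Lwd + 2LwPw) − Lw(Ld + ΛPw)`  (F3a)   and   `D₃ = N(NΛ + Lwd + 2LwPw) − Lw((1−2Λ)Ld + N Pw)`, `N = Λ(1−Λ)`  (F3b),
are identified here as derivatives in `w` of the two vertical logarithmic derivatives
  `η(w,z) := Pw + Ld/Λ`  (= `∂₂ log|∂₂v_b|`, the log-derivative of the vertical shear)   and   `ξ(w,z) := Pw − Ld/(1−Λ)`  (= `∂₂ log|∂_b W|`):
* `hasDerivAt_along_w` — `w ↦ g(w,z)` has derivative `Dg(w,z)(1,0)`;  `fderiv_pair_eq` — `Dg(p)(a,b) = a·Dg(p)(1,0) + b·Dg(p)(0,1)`;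
* `fderiv_partial_swap` — symmetry of the mixed second partials of a `C²` function on `ℝ × ℝ`;
* `hasDerivAt_eta` — **`∂_w η = D₁/Λ²`**;   `hasDerivAt_xi` — **`∂_w ξ = Λ + D₁/Λ² − D₃/N²`**.
So on the Branch-2b region (`D₁ ≡ D₃ ≡ 0`): `∂_w η = 0` and `∂_w ξ = Λ` — the two inputs of the separation of variables in brick F4.

WHAT THIS IS NOT: not a claim about Navier–Stokes — calculus bookkeeping (bears_on LADDER-NS N0 via crux K2 = stmt-19708).
-/

noncomputable section

-- the summit and its single sub-problem share the name (CONVENTIONS §1), as in every Theorems file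
set_option linter.dupNamespace false

namespace Summit.NavierStokesRegularity.NavierStokesRegularity.Theorems.PoloidalWindowDoorPoloidalWindowRigidityUntwistedLogDerivatives

open Set Function Filter Topology
open Summit.NavierStokesRegularity.NavierStokesRegularity.Theorems.PoloidalWindowDoorPoloidalWindowRigidityUntwistedSeparation

/-! ### Two-variable calculus helpers -/

/-- `w ↦ (w, z)` has derivative `(1, 0)`. [folklore] -/
theorem hasDerivAt_pair_left (w z : ℝ) : HasDerivAt (fun w' : ℝ => (w', z)) ((1 : ℝ), (0 : ℝ)) w := by
  have h := (hasDerivAt_id w).prodMk (hasDerivAt_const w z)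
  simpa using h

/-- **Derivative along `w` of a function of `(w,z)`**: `Dg(w,z)(1,0)`. [folklore] -/
theorem hasDerivAt_along_w {g : ℝ × ℝ → ℝ} {w z : ℝ} (hg : DifferentiableAt ℝ g (w, z)) :
    HasDerivAt (fun w' : ℝ => g (w', z)) (fderiv ℝ g (w, z) ((1 : ℝ), (0 : ℝ))) w := by
  have h := hg.hasFDerivAt.comp_hasDerivAt w (hasDerivAt_pair_left w z)
  exact h

/-- Linearity: `Dg(p)(a,b) = a·Dg(p)(1,0) + b·Dg(p)(0,1)`. [folklore] -/
theorem fderiv_pair_eq (g : ℝ × ℝ → ℝ) (p : ℝ × ℝ) (a b : ℝ) :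
    fderiv ℝ g p (a, b) = a * fderiv ℝ g p ((1 : ℝ), (0 : ℝ)) + b * fderiv ℝ g p ((0 : ℝ), (1 : ℝ)) := by
  have e : ((a, b) : ℝ × ℝ) = a • ((1 : ℝ), (0 : ℝ)) + b • ((0 : ℝ), (1 : ℝ)) := by ext <;> simp
  rw [e, map_add, map_smul, map_smul, smul_eq_mul, smul_eq_mul]

/-- The `z`-partial `p ↦ Dg(p)(0,1)` of a function `C²` at `p` is differentiable at `p`. [folklore] -/
theorem differentiableAt_zPartial {g : ℝ × ℝ → ℝ} {p : ℝ × ℝ} (hg : ContDiffAt ℝ 2 g p) :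
    DifferentiableAt ℝ (fun q => fderiv ℝ g q ((0 : ℝ), (1 : ℝ))) p := by
  have h1 : ContDiffAt ℝ 1 (fderiv ℝ g) p := hg.fderiv_right (m := 1) (by norm_num)
  exact (h1.clm_apply contDiffAt_const).differentiableAt one_ne_zero

/-- **Symmetry of mixed partials on `ℝ × ℝ`**: for `g` of class `C²` at `p`, `∂_w(∂_z g)(p) = ∂_z(∂_w g)(p)`. [folklore] -/
theorem fderiv_partial_swap {g : ℝ × ℝ → ℝ} {p : ℝ × ℝ} (hg : ContDiffAt ℝ 2 g p) :
    fderiv ℝ (fun q => fderiv ℝ g q ((0 : ℝ), (1 : ℝ))) p ((1 : ℝ), (0 : ℝ)) =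
      fderiv ℝ (fun q => fderiv ℝ g q ((1 : ℝ), (0 : ℝ))) p ((0 : ℝ), (1 : ℝ)) := by
  have hd : DifferentiableAt ℝ (fderiv ℝ g) p := (hg.fderiv_right (m := 1) (by norm_num)).differentiableAt one_ne_zero
  rw [fderiv_clm_apply hd (differentiableAt_const _), fderiv_clm_apply hd (differentiableAt_const _)]
  simp only [fderiv_fun_const, Pi.zero_apply, ContinuousLinearMap.comp_zero, zero_add, ContinuousLinearMap.flip_apply]
  exact (hg.isSymmSndFDerivAt (by simp)) _ _

/-! ### The vertical logarithmic derivatives and their `w`-derivatives -/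

section LogDerivatives

variable {P Λ : ℝ × ℝ → ℝ} {w z : ℝ}

/-- **`∂_w η = D₁/Λ²`** for `η(w,z) = Pw + DΛ(P,1)/Λ`.  Precisely: with all symbols evaluated at `p = (w,z)`, the function `w′ ↦ η(w′,z)` has derivative
`D₁/Λ²`, `D₁ = Λ(ΛPww + Lwd + 2LwPw) − Lw(Ld + ΛPw)` (the Wronskian of brick F3a).  Requires `P, Λ ∈ C²` at `p` and `Λ(p) ≠ 0`. [folklore] -/
theorem hasDerivAt_eta (hP : ContDiffAt ℝ 2 P (w, z)) (hΛ : ContDiffAt ℝ 2 Λ (w, z)) (hL0 : Λ (w, z) ≠ 0) :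
    HasDerivAt (fun w' : ℝ => fderiv ℝ P (w', z) ((1 : ℝ), (0 : ℝ)) + fderiv ℝ Λ (w', z) (P (w', z), 1) / Λ (w', z))
      ((Λ (w, z) * (Λ (w, z) * fderiv ℝ (fun q => fderiv ℝ P q ((1 : ℝ), (0 : ℝ))) (w, z) (1, 0) +
            fderiv ℝ (fun q => fderiv ℝ Λ q ((1 : ℝ), (0 : ℝ))) (w, z) (P (w, z), 1) +
            2 * fderiv ℝ Λ (w, z) (1, 0) * fderiv ℝ P (w, z) (1, 0)) -
          fderiv ℝ Λ (w, z) (1, 0) * (fderiv ℝ Λ (w, z) (P (w, z), 1) + Λ (w, z) * fderiv ℝ P (w, z) (1, 0))) /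
        Λ (w, z) ^ 2) w := by
  -- differentiability of the building blocks at `(w, z)`
  have hPd : DifferentiableAt ℝ P (w, z) := hP.differentiableAt (by norm_num)
  have hΛd : DifferentiableAt ℝ Λ (w, z) := hΛ.differentiableAt (by norm_num)
  have hPw : DifferentiableAt ℝ (fun q => fderiv ℝ P q ((1 : ℝ), (0 : ℝ))) (w, z) := differentiableAt_wPartial hP
  have hLw : DifferentiableAt ℝ (fun q => fderiv ℝ Λ q ((1 : ℝ), (0 : ℝ))) (w, z) := differentiableAt_wPartial hΛ
  have hLz : DifferentiableAt ℝ (fun q => fderiv ℝ Λ q ((0 : ℝ), (1 : ℝ))) (w, z) := differentiableAt_zPartial hΛ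
  -- one-variable derivatives along `w`
  have dPw := hasDerivAt_along_w (g := fun q => fderiv ℝ P q ((1 : ℝ), (0 : ℝ))) hPw
  have dP := hasDerivAt_along_w hPd
  have dL := hasDerivAt_along_w hΛd
  have dLw := hasDerivAt_along_w (g := fun q => fderiv ℝ Λ q ((1 : ℝ), (0 : ℝ))) hLw
  have dLz := hasDerivAt_along_w (g := fun q => fderiv ℝ Λ q ((0 : ℝ), (1 : ℝ))) hLz
  -- rewrite the directional derivative `DΛ(w',z)(P,1) = P·Lw + Lz`
  have hfun : (fun w' : ℝ => fderiv ℝ P (w', z) ((1 : ℝ), (0 : ℝ)) + fderiv ℝ Λ (w', z) (P (w', z), 1) / Λ (w', z)) =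
      fun w' : ℝ => fderiv ℝ P (w', z) ((1 : ℝ), (0 : ℝ)) +
        (P (w', z) * fderiv ℝ Λ (w', z) ((1 : ℝ), (0 : ℝ)) + 1 * fderiv ℝ Λ (w', z) ((0 : ℝ), (1 : ℝ))) / Λ (w', z) := by
    funext w'; rw [fderiv_pair_eq Λ (w', z) (P (w', z)) 1]
  rw [hfun]
  have hnum := ((dP.mul dLw).add (dLz.const_mul 1))
  have hquot := (hnum.div dL hL0)
  have htot := dPw.add hquot
  refine htot.congr_deriv ?_
  -- identify with `D₁/Λ²`: expand `Ld`, `Lwd`, swap the mixed partial of `Λ`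
  rw [fderiv_pair_eq Λ (w, z) (P (w, z)) 1, fderiv_pair_eq (fun q => fderiv ℝ Λ q ((1 : ℝ), (0 : ℝ))) (w, z) (P (w, z)) 1,
    ← fderiv_partial_swap hΛ]
  simp only [Pi.add_apply, Pi.mul_apply, one_mul]
  field_simp
  ring

/-- **`∂_w ξ = Λ + D₁/Λ² − D₃/N²`** for `ξ(w,z) = Pw − DΛ(P,1)/(1−Λ)`, `N = Λ(1−Λ)`, `D₃ = N(NΛ + Lwd + 2LwPw) − Lw((1−2Λ)Ld + N Pw)` (the Wronskian of
brick F3b).  Requires `P, Λ ∈ C²` at `p` and `Λ(p) ∉ {0, 1}`. [folklore] -/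
theorem hasDerivAt_xi (hP : ContDiffAt ℝ 2 P (w, z)) (hΛ : ContDiffAt ℝ 2 Λ (w, z)) (hL0 : Λ (w, z) ≠ 0) (hL1 : Λ (w, z) ≠ 1) :
    HasDerivAt (fun w' : ℝ => fderiv ℝ P (w', z) ((1 : ℝ), (0 : ℝ)) - fderiv ℝ Λ (w', z) (P (w', z), 1) / (1 - Λ (w', z)))
      (Λ (w, z) +
        (Λ (w, z) * (Λ (w, z) * fderiv ℝ (fun q => fderiv ℝ P q ((1 : ℝ), (0 : ℝ))) (w, z) (1, 0) +
              fderiv ℝ (fun q => fderiv ℝ Λ q ((1 : ℝ), (0 : ℝ))) (w, z) (P (w, z), 1) +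
              2 * fderiv ℝ Λ (w, z) (1, 0) * fderiv ℝ P (w, z) (1, 0)) -
            fderiv ℝ Λ (w, z) (1, 0) * (fderiv ℝ Λ (w, z) (P (w, z), 1) + Λ (w, z) * fderiv ℝ P (w, z) (1, 0))) /
          Λ (w, z) ^ 2 -
        ((Λ (w, z) * (1 - Λ (w, z))) *
              (Λ (w, z) * (1 - Λ (w, z)) * Λ (w, z) +
                fderiv ℝ (fun q => fderiv ℝ Λ q ((1 : ℝ), (0 : ℝ))) (w, z) (P (w, z), 1) +
                2 * fderiv ℝ Λ (w, z) (1, 0) * fderiv ℝ P (w, z) (1, 0)) -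
            fderiv ℝ Λ (w, z) (1, 0) *
              ((1 - 2 * Λ (w, z)) * fderiv ℝ Λ (w, z) (P (w, z), 1) +
                Λ (w, z) * (1 - Λ (w, z)) * fderiv ℝ P (w, z) (1, 0))) /
          (Λ (w, z) * (1 - Λ (w, z))) ^ 2) w := by
  have hPd : DifferentiableAt ℝ P (w, z) := hP.differentiableAt (by norm_num)
  have hΛd : DifferentiableAt ℝ Λ (w, z) := hΛ.differentiableAt (by norm_num)
  have hPw : DifferentiableAt ℝ (fun q => fderiv ℝ P q ((1 : ℝ), (0 : ℝ))) (w, z) := differentiableAt_wPartial hP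
  have hLw : DifferentiableAt ℝ (fun q => fderiv ℝ Λ q ((1 : ℝ), (0 : ℝ))) (w, z) := differentiableAt_wPartial hΛ
  have hLz : DifferentiableAt ℝ (fun q => fderiv ℝ Λ q ((0 : ℝ), (1 : ℝ))) (w, z) := differentiableAt_zPartial hΛ
  have dPw := hasDerivAt_along_w (g := fun q => fderiv ℝ P q ((1 : ℝ), (0 : ℝ))) hPw
  have dP := hasDerivAt_along_w hPd
  have dL := hasDerivAt_along_w hΛd
  have dLw := hasDerivAt_along_w (g := fun q => fderiv ℝ Λ q ((1 : ℝ), (0 : ℝ))) hLw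
  have dLz := hasDerivAt_along_w (g := fun q => fderiv ℝ Λ q ((0 : ℝ), (1 : ℝ))) hLz
  have h1L : (1 : ℝ) - Λ (w, z) ≠ 0 := sub_ne_zero.mpr (Ne.symm hL1)
  have hfun : (fun w' : ℝ => fderiv ℝ P (w', z) ((1 : ℝ), (0 : ℝ)) - fderiv ℝ Λ (w', z) (P (w', z), 1) / (1 - Λ (w', z))) =
      fun w' : ℝ => fderiv ℝ P (w', z) ((1 : ℝ), (0 : ℝ)) -
        (P (w', z) * fderiv ℝ Λ (w', z) ((1 : ℝ), (0 : ℝ)) + 1 * fderiv ℝ Λ (w', z) ((0 : ℝ), (1 : ℝ))) / (1 - Λ (w', z)) := by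
    funext w'; rw [fderiv_pair_eq Λ (w', z) (P (w', z)) 1]
  rw [hfun]
  have hnum := ((dP.mul dLw).add (dLz.const_mul 1))
  have hden : HasDerivAt (fun w' : ℝ => 1 - Λ (w', z)) (-(fderiv ℝ Λ (w, z) ((1 : ℝ), (0 : ℝ)))) w := by
    simpa using dL.const_sub 1
  have hquot := (hnum.div hden h1L)
  have htot := dPw.sub hquot
  refine htot.congr_deriv ?_
  rw [fderiv_pair_eq Λ (w, z) (P (w, z)) 1, fderiv_pair_eq (fun q => fderiv ℝ Λ q ((1 : ℝ), (0 : ℝ))) (w, z) (P (w, z)) 1,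
    ← fderiv_partial_swap hΛ]
  simp only [Pi.add_apply, Pi.mul_apply, one_mul]
  field_simp
  ring

end LogDerivatives

end Summit.NavierStokesRegularity.NavierStokesRegularity.Theorems.PoloidalWindowDoorPoloidalWindowRigidityUntwistedLogDerivatives

end
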